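import Literature.MathematicalPhysics.QuantumFieldTheory.Federbush1986.ConstrainedMinimality

/-!
# `Federbush1986.ModeEstimatesPerRow` — [Federbush1986PhaseCellI] §0 pp. 320–321, ESTIMATES 0.1–0.7 ONE BY ONE for the mode of
# the concrete Bałaban averaging: each displayed estimate (0.2), (0.3), (0.4)–(0.5), (0.6), (0.7)–(0.8), (0.9), (0.10)–(0.11)
# (`≤` reading) HOLDS for an action-minimising potential compatible with any box-supported bond assignment — PROVED
# (projections of `CorrectedMode.modeEstimatesLe`)

statement-level skeleton of published theorems with citation tags; proofs where landed; nothing here is a claim about the Yang–Mills mass gap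

CITATION HEADER.  P. Federbush, *A phase cell approach to Yang–Mills theory. I. Modes, lattice-continuum duality*, Commun.
Math. Phys. **107** (1986) 319–329 [Federbush1986PhaseCellI]: §0 pp. 320–321 verbatim *«We will find an A_μ(x) compatible
with this assignment, minimizing the continuum action, and "smooth" enough, so that the following results hold for the
induced assignments to the finer lattices, and for A_μ(x)»*, followed by **Estimate 0.1** «|A_μ(x)| < c (1/L) e^{−γ|x−z|/L} |A(m)|
(0.2)», **Estimate 0.2** «|DA_μ(x)| < (c/L²) e^{−γ|x−z|/L} |A(m)| (0.3)», **Estimate 0.3** (0.4)–(0.5), **Estimate 0.4** «|A(e)| <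
c (l/L) e^{−γd(e,z)/L} |A(m)| (0.6)», **Estimate 0.5** (0.7)–(0.8), **Estimate 0.6** «|A_{∂p}| < c (l/L)² e^{−γd(p,z)/L} |A(m)| (0.9)»,
**Estimate 0.7** (0.10)–(0.11) (p. 321).  Unit `lit-balaban-r17` gen 13 (fold owner of the Federbush block); SKELETON rows
F1.Eq0.2, F1.Eq0.3, F1.Eq0.4-0.5, F1.Eq0.6, F1.Eq0.7-0.8, F1.Eq0.9, F1.Eq0.10-0.11 (and F1.Eq3.1, the conjunction) of
`run/shared/lean/pub/lit-balaban/lit-balaban-r17/SKELETON-r17.md`.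

WHAT THIS MODULE PROVIDES.  The tree proves the whole statement of §0 in the `≤` reading for the concrete averaging
`axialTreeAveraging` with NO hypothesis: `CorrectedMode.modeEstimatesLe : axialTreeAveraging.ModeEstimatesLe` (r17 gen 12,
`ConstrainedMinimality`, p327394; the printed strict «<» forms are vacuous-false at degenerate data, `AbelianAveraging.not_modeEstimates`,
`not_estimate01_zero`, `not_estimate05_self`, `not_estimate07_self` — a typing point, nothing in print fails).  This file records, one
`theorem` per printed Estimate, the corresponding clause with print's quantifier shape — for every `c₀ > 0` there are constants
`c, γ > 0` (and `c_ε` for 0.3/0.7) such that for every level `r₀`, centre `z` and bond assignment `a` supported in `d(·, z) ≤ c₀ℓ_{r₀}`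
there is a potential `A` minimising the continuum action under the constraint of the level-`r₀` bond variables `a`
(`IsConstrainedMinimizer`) which satisfies that Estimate with `L = ℓ_{r₀}` and `|A(m)| = max |a|`:
`exists_minimizer_estimate01Le`, `…02Le`, `…03Le`, `…04Le`, `…05Le`, `…06Le`, `…07Le`.  They are projections of
`modeEstimatesLe` (the SAME `A` carries all seven estimates there; here each is stated alone, as printed and numbered).
Theorems only; no definition, no `Prop` fact, no `sorry`; axioms standard.

v1.1 (r17 gen 14; referee note DF-g49-1 of ref-5 gen 49): DOCSTRINGS ONLY — the quotations of Estimates 0.4, 0.6 and 0.7 below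
now reproduce the printed sentences of pp. 320–321 verbatim (v1 had paraphrases inside quotation marks: «edge of length scale l,
then», and in (0.10) the factor `(d(p₁,p₂))^{1−ε}` moved to the left); every declaration is byte-identical to v1 (p329373).
-/

namespace Literature.MathematicalPhysics.QuantumFieldTheory.Federbush1986

namespace CorrectedMode

open AbelianAveraging

/-- **Estimate 0.1 (0.2), `≤` reading, for the mode of the concrete averaging**: «|A_μ(x)| < c (1/L) e^{−γ|x−z|/L} |A(m)|» holds (with
`≤`) for an action-minimising potential compatible with any bond assignment supported within `c₀L` of `z`, `L = ℓ_{r₀}`.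
[cite: Federbush1986PhaseCellI, Estimate 0.1 (0.2) p. 320; §0 p. 320] -/
theorem exists_minimizer_estimate01Le :
    ∀ c₀ > (0 : ℝ), ∃ c > (0 : ℝ), ∃ γ > (0 : ℝ), ∀ (r₀ : ℕ) (z : E4) (a : Edge r₀ → ℝ),
      (∀ e : Edge r₀, c₀ * latLen r₀ < dist e.src z → a e = 0) →
        ∃ A : E4 → Fin 4 → ℝ, axialTreeAveraging.IsConstrainedMinimizer r₀ a A ∧
          Estimate01Le c γ (latLen r₀) z (maxAssign a) A := by
  intro c₀ hc₀
  obtain ⟨c, hc, γ, hγ, cε, h⟩ := modeEstimatesLe c₀ hc₀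
  refine ⟨c, hc, γ, hγ, fun r₀ z a ha => ?_⟩
  obtain ⟨A, hmin, h1, -, -, -, -, -, -⟩ := h r₀ z a ha
  exact ⟨A, hmin, h1⟩

/-- **Estimate 0.2 (0.3), `≤` reading, for the mode of the concrete averaging**: «|DA_μ(x)| < (c/L²) e^{−γ|x−z|/L} |A(m)|, where D
indicates any first partial.» [cite: Federbush1986PhaseCellI, Estimate 0.2 (0.3) p. 320; §0 p. 320] -/
theorem exists_minimizer_estimate02Le :
    ∀ c₀ > (0 : ℝ), ∃ c > (0 : ℝ), ∃ γ > (0 : ℝ), ∀ (r₀ : ℕ) (z : E4) (a : Edge r₀ → ℝ),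
      (∀ e : Edge r₀, c₀ * latLen r₀ < dist e.src z → a e = 0) →
        ∃ A : E4 → Fin 4 → ℝ, axialTreeAveraging.IsConstrainedMinimizer r₀ a A ∧
          Estimate02Le c γ (latLen r₀) z (maxAssign a) A := by
  intro c₀ hc₀
  obtain ⟨c, hc, γ, hγ, cε, h⟩ := modeEstimatesLe c₀ hc₀
  refine ⟨c, hc, γ, hγ, fun r₀ z a ha => ?_⟩
  obtain ⟨A, hmin, -, h2, -, -, -, -, -⟩ := h r₀ z a ha
  exact ⟨A, hmin, h2⟩

/-- **Estimate 0.3 (0.4)–(0.5), `≤` reading, for the mode of the concrete averaging**: «(1/|x−y|^{1−ε}) |DA_μ(x) − DA_μ(y)| <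
(c_ε/L^{3−ε}) e^{−γ|x−z|/L} |A(m)| each ε > 0, (0.4) where |x − y| < cL. (0.5)» [cite: Federbush1986PhaseCellI, Estimate 0.3
(0.4)–(0.5) p. 320; §0 p. 320] -/
theorem exists_minimizer_estimate03Le :
    ∀ c₀ > (0 : ℝ), ∃ c > (0 : ℝ), ∃ γ > (0 : ℝ), ∃ cε : ℝ → ℝ, ∀ (r₀ : ℕ) (z : E4) (a : Edge r₀ → ℝ),
      (∀ e : Edge r₀, c₀ * latLen r₀ < dist e.src z → a e = 0) →
        ∃ A : E4 → Fin 4 → ℝ, axialTreeAveraging.IsConstrainedMinimizer r₀ a A ∧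
          Estimate03Le c γ (latLen r₀) cε z (maxAssign a) A := by
  intro c₀ hc₀
  obtain ⟨c, hc, γ, hγ, cε, h⟩ := modeEstimatesLe c₀ hc₀
  refine ⟨c, hc, γ, hγ, cε, fun r₀ z a ha => ?_⟩
  obtain ⟨A, hmin, -, -, h3, -, -, -, -⟩ := h r₀ z a ha
  exact ⟨A, hmin, h3⟩

/-- **Estimate 0.4 (0.6), `≤` reading, for the mode of the concrete averaging**: «Let e be an edge at length scale l, and A(e)
the corresponding assigned group element |A(e)| < c (l/L) e^{−γd(e,z)/L} |A(m)|. (0.6)» (p. 320, verbatim) — for the induced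
assignments at all levels `s ≥ r₀`. [cite: Federbush1986PhaseCellI, Estimate 0.4 (0.6) p. 320; §0 p. 320] -/
theorem exists_minimizer_estimate04Le :
    ∀ c₀ > (0 : ℝ), ∃ c > (0 : ℝ), ∃ γ > (0 : ℝ), ∀ (r₀ : ℕ) (z : E4) (a : Edge r₀ → ℝ),
      (∀ e : Edge r₀, c₀ * latLen r₀ < dist e.src z → a e = 0) →
        ∃ A : E4 → Fin 4 → ℝ, axialTreeAveraging.IsConstrainedMinimizer r₀ a A ∧
          axialTreeAveraging.Estimate04Le r₀ c γ (latLen r₀) z (maxAssign a) A := by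
  intro c₀ hc₀
  obtain ⟨c, hc, γ, hγ, cε, h⟩ := modeEstimatesLe c₀ hc₀
  refine ⟨c, hc, γ, hγ, fun r₀ z a ha => ?_⟩
  obtain ⟨A, hmin, -, -, -, h4, -, -, -⟩ := h r₀ z a ha
  exact ⟨A, hmin, h4⟩

/-- **Estimate 0.5 (0.7)–(0.8), `≤` reading, for the mode of the concrete averaging**: «Let e₁ and e₂ be parallel (oriented)
edges at length scale l, |A(e₁) − A(e₂)| < c (l/L)(d(e₁,e₂)/L) e^{−γd(e₁,z)/L} |A(m)|, (0.7) where d(e₁, e₂) < cL. (0.8)» (one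
constant `c` for both occurrences, as printed). [cite: Federbush1986PhaseCellI, Estimate 0.5 (0.7)–(0.8) p. 320; §0 p. 320] -/
theorem exists_minimizer_estimate05Le :
    ∀ c₀ > (0 : ℝ), ∃ c > (0 : ℝ), ∃ γ > (0 : ℝ), ∀ (r₀ : ℕ) (z : E4) (a : Edge r₀ → ℝ),
      (∀ e : Edge r₀, c₀ * latLen r₀ < dist e.src z → a e = 0) →
        ∃ A : E4 → Fin 4 → ℝ, axialTreeAveraging.IsConstrainedMinimizer r₀ a A ∧
          axialTreeAveraging.Estimate05Le r₀ c c γ (latLen r₀) z (maxAssign a) A := by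
  intro c₀ hc₀
  obtain ⟨c, hc, γ, hγ, cε, h⟩ := modeEstimatesLe c₀ hc₀
  refine ⟨c, hc, γ, hγ, fun r₀ z a ha => ?_⟩
  obtain ⟨A, hmin, -, -, -, -, h5, -, -⟩ := h r₀ z a ha
  exact ⟨A, hmin, h5⟩

/-- **Estimate 0.6 (0.9), `≤` reading, for the mode of the concrete averaging**: «Let p be a plaquette at length scale l, and
A_{∂p} the corresponding group assignment, |A_{∂p}| < c (l/L)² e^{−γd(p,z)/L} |A(m)|. (0.9)» (p. 320, verbatim).
[cite: Federbush1986PhaseCellI, Estimate 0.6 (0.9) p. 320; §0 p. 320] -/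
theorem exists_minimizer_estimate06Le :
    ∀ c₀ > (0 : ℝ), ∃ c > (0 : ℝ), ∃ γ > (0 : ℝ), ∀ (r₀ : ℕ) (z : E4) (a : Edge r₀ → ℝ),
      (∀ e : Edge r₀, c₀ * latLen r₀ < dist e.src z → a e = 0) →
        ∃ A : E4 → Fin 4 → ℝ, axialTreeAveraging.IsConstrainedMinimizer r₀ a A ∧
          axialTreeAveraging.Estimate06Le r₀ c γ (latLen r₀) z (maxAssign a) A := by
  intro c₀ hc₀
  obtain ⟨c, hc, γ, hγ, cε, h⟩ := modeEstimatesLe c₀ hc₀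
  refine ⟨c, hc, γ, hγ, fun r₀ z a ha => ?_⟩
  obtain ⟨A, hmin, -, -, -, -, -, h6, -⟩ := h r₀ z a ha
  exact ⟨A, hmin, h6⟩

/-- **Estimate 0.7 (0.10)–(0.11), `≤` reading, for the mode of the concrete averaging**: «Let p₁ and p₂ be parallel (oriented)
plaquettes at length scale l, |A_{∂p₁} − A_{∂p₂}| < c_ε (d(p₁,p₂))^{1−ε} (l²/L^{3−ε}) e^{−γd(p₁,z)/L} |A(m)| each ε > 0, (0.10)
where d(p₁,p₂) is measured between corresponding vertices and d(p₁,p₂) < cL. (0.11)» (p. 321, verbatim; the typed predicate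
`Estimate07Le` carries the factor `d(p₁,p₂)^{1−ε}` on the right exactly as printed). [cite: Federbush1986PhaseCellI,
Estimate 0.7 (0.10)–(0.11) p. 321; §0 p. 320] -/
theorem exists_minimizer_estimate07Le :
    ∀ c₀ > (0 : ℝ), ∃ c > (0 : ℝ), ∃ γ > (0 : ℝ), ∃ cε : ℝ → ℝ, ∀ (r₀ : ℕ) (z : E4) (a : Edge r₀ → ℝ),
      (∀ e : Edge r₀, c₀ * latLen r₀ < dist e.src z → a e = 0) →
        ∃ A : E4 → Fin 4 → ℝ, axialTreeAveraging.IsConstrainedMinimizer r₀ a A ∧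
          axialTreeAveraging.Estimate07Le r₀ c γ (latLen r₀) cε z (maxAssign a) A := by
  intro c₀ hc₀
  obtain ⟨c, hc, γ, hγ, cε, h⟩ := modeEstimatesLe c₀ hc₀
  refine ⟨c, hc, γ, hγ, cε, fun r₀ z a ha => ?_⟩
  obtain ⟨A, hmin, -, -, -, -, -, -, h7⟩ := h r₀ z a ha
  exact ⟨A, hmin, h7⟩

end CorrectedMode

end Literature.MathematicalPhysics.QuantumFieldTheory.Federbush1986
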